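import Mathlib
import Summits.CriticalPhenomena.CardyFormulaZ2.Theorems.CardyMagicRigidityPositiveConeDefs
import Summits.CriticalPhenomena.CardyFormulaZ2.Theorems.CardyMagicRigidityNestingRigiditySoftMachineSite
import Summits.CriticalPhenomena.CardyFormulaZ2.Theorems.CardyMagicRigidityNestingRigiditySoftMachineMeasurableAll
import Summits.CriticalPhenomena.CardyFormulaZ2.Theorems.CardyMagicRigidityNestingRigidityPrecompactnessFullSequence
import HarnessLib

/-!
# Soft machine, brick 9: T1m for `tEns` in final form, and `PrecompactRegular tEns` from the regular-limit input alone

Crux `Summit.CriticalPhenomena.CardyFormulaZ2.Theses.CardyMagicRigidity.NestingRigidity`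
(stmt-CriticalPhenomena-4835), line `positive-cone-weight-doubling`, registered stubs `stub_tamePrecompactness :
TamePrecompact zEns ∧ TamePrecompact tEns` (r4) / `stub_precompactness : PrecompactRegular zEns ∧
PrecompactRegular tEns` (r3).  Final packaging of the site-`𝕋` output of THE SOFT MACHINE:

* `precompactLaw_measurable_tEns` (registered anchor, the shape recommended by the lead) — along every mesh
  sequence `δₖ → 0⁺`, a subsequence of the laws of `tEns.X δₖ = siteLoopConfig δₖ` converges in DKKMO's coupling
  distance to a law presented on `([0,1], Leb)`, with MEASURABLE closeness events against BOTH lattice ensembles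
  at EVERY real mesh (brick 8 `softMachine_precompactLaw_tEns` + brick 7b
  `softMachine_measurableSet_isClose_latticeEnsembles_all`).  UNCONDITIONAL: no named fact enters (not
  `exists_isFullPlaneCNLLaw`).
* `precompactLaw_measurable_hit_tEns` — the same keeping the intrinsic property of the presentation (measurable
  hitting events of closed sets of unbased loops), for later use (measurability of typed counts).
* `precompactRegular_tEns_of_regularLimit` — hence `PrecompactRegular tEns` follows from the law-level
  regular-modification statement (T2m) ALONE (`precompactRegular_of_measurable_limits`, p129294), the `tEns` half
  of `stub_precompactness` being thereby reduced to the hard limit fields (boundary, separating, dust) of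
  `regularModification_of_ae_boundary_separating` (p129759).
-/

noncomputable section

open MeasureTheory Set Filter Metric TopologicalSpace Function
open scoped Topology ENNReal NNReal unitInterval

namespace Summit.CriticalPhenomena.CardyFormulaZ2.Cruxes.NestingRigidity.PositiveConeWeightDoubling

open Literature.Probability.RandomPlanarGeometry Literature.Probability.Percolation
  Literature.Probability.LatticeModels
open Summit.CriticalPhenomena.CardyFormulaZ2.Cruxes.NestingRigidity.RingCloudTomography

/-- **T1m for `tEns` with the intrinsic hitting measurability of the presentation** (all meshes). -/
theorem precompactLaw_measurable_hit_tEns (δs : ℕ → ℝ) (hδs : Tendsto δs atTop (𝓝[>] (0 : ℝ))) :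
    ∃ φ : ℕ → ℕ, StrictMono φ ∧ ∃ X : unitInterval → LoopConfig ℂ,
      (∀ (i : Fin 2) (Q : Set (UnbasedLoop ℂ)), IsClosed Q → MeasurableSet {s | ∃ u ∈ (X s).F i, u ∈ Q}) ∧
      (∀ (δ ε : ℝ), ∀ E' ∈ latticeEnsembles,
        MeasurableSet {p : E'.Ω × unitInterval | LoopConfig.IsClose ε (E'.X δ p.1) (X p.2)}) ∧
      Tendsto (fun k : ℕ ↦ LoopConfig.cnLawEDist tEns.P (tEns.X (δs (φ k))) volume X) atTop (𝓝 0) := by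
  obtain ⟨φ, hφ, X, hXhit, -, hconv⟩ := softMachine_precompactLaw_tEns δs hδs
  exact ⟨φ, hφ, X, hXhit, fun δ ε E' hE' ↦
    softMachine_measurableSet_isClose_latticeEnsembles_all E' hE' δ ε unitInterval X hXhit, hconv⟩

/-- **Registered anchor** (`precompactLaw_measurable_tEns`, T1m for `tEns`, UNCONDITIONAL): along every mesh sequence
`δₖ → 0⁺`, a subsequence of the laws of the typed loop ensembles of critical site percolation converges in DKKMO's
coupling distance `d_CN` to a law presented on `([0,1], Leb)` whose closeness events against both lattice ensembles
are measurable at every mesh. -/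
theorem precompactLaw_measurable_tEns : ∀ δs : ℕ → ℝ, Tendsto δs atTop (𝓝[>] (0 : ℝ)) →
    ∃ φ : ℕ → ℕ, StrictMono φ ∧ ∃ X : unitInterval → LoopConfig ℂ,
      (∀ (δ ε : ℝ), ∀ E' ∈ latticeEnsembles,
        MeasurableSet {p : E'.Ω × unitInterval | LoopConfig.IsClose ε (E'.X δ p.1) (X p.2)}) ∧
      Tendsto (fun k : ℕ ↦ LoopConfig.cnLawEDist tEns.P (tEns.X (δs (φ k))) volume X) atTop (𝓝 0) := by
  intro δs hδs
  obtain ⟨φ, hφ, X, -, hmeas, hconv⟩ := precompactLaw_measurable_hit_tEns δs hδs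
  exact ⟨φ, hφ, X, hmeas, hconv⟩

/-- **`PrecompactRegular tEns` from the regular-limit statement alone.**  With T1m for `tEns` now unconditional, the
`tEns` half of `stub_precompactness` reduces to T2m: every sequential `d_CN`-limit presentation of `tEns` with
measurable closeness events has an a.e.-`Regular` replacement with the same limit property
(`precompactRegular_of_measurable_limits`, p129294). -/
theorem precompactRegular_tEns_of_regularLimit
    (h₂ : ∀ (δs : ℕ → ℝ) (X : unitInterval → LoopConfig ℂ), Tendsto δs atTop (𝓝[>] (0 : ℝ)) →
      (∀ (δ ε : ℝ), MeasurableSet {p : tEns.Ω × unitInterval | LoopConfig.IsClose ε (tEns.X δ p.1) (X p.2)}) →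
      Tendsto (fun k : ℕ ↦ LoopConfig.cnLawEDist tEns.P (tEns.X (δs k)) volume X) atTop (𝓝 0) →
      ∃ X' : unitInterval → LoopConfig ℂ, (∀ᵐ s : unitInterval, Regular (X' s)) ∧
        Tendsto (fun k : ℕ ↦ LoopConfig.cnLawEDist tEns.P (tEns.X (δs k)) volume X') atTop (𝓝 0)) :
    PrecompactRegular tEns := by
  refine precompactRegular_of_measurable_limits tEns (fun δs hδs ↦ ?_) h₂
  obtain ⟨φ, hφ, X, hmeas, hconv⟩ := precompactLaw_measurable_tEns δs hδs
  exact ⟨φ, hφ, X, fun δ ε ↦ hmeas δ ε tEns tEns_mem, hconv⟩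

end Summit.CriticalPhenomena.CardyFormulaZ2.Cruxes.NestingRigidity.PositiveConeWeightDoubling

end
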